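import Literature.Topology.FourManifolds.LatticeFormsReflectionPairsCommutators
import Literature.Topology.FourManifolds.LatticeFormsOrthogonalGroupHyperbolicSum
import Literature.Topology.FourManifolds.LatticeFormsOrthogonalGroupPosTwoReflections
import Mathlib.GroupTheory.Coset.Card
import Mathlib.Data.ZMod.Basic
import HarnessLib

/-!
# The abelianisation of a group generated by `(2ε)`-reflections is an elementary abelian `2`-group of order dividing
# `2^N`, `N` = number of orbits of roots — GHS Thm. 1.3 by its printed rewriting argument, general `N`
# (Gritsenko–Hulek–Sankaran, *J. Algebra* 322 (2009) 463–478, Thm. 1.3 and its proof, p. 3)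

Trunk T-4MAN vocabulary. Row g50-#9 (`LatticeFormsReflectionPairsCommutators`) formalized the printed proof of Thm. 1.3 for
ONE orbit of roots (`N = 1`: the classes of reflection words modulo commutator words are cut out by `det`). This file
formalizes the general mechanism of the printed proof — "we can rewrite any class modulo commutator as the class of a product
`σ_{a_1}⋯σ_{a_n}`, where the `(−2)`-vectors `a_i` all belong to different orbits […] Its order divides `2^N`" — GROUP-FREE,
in the tree's vocabulary of words (`wordProd`, `IsWordIn`): for ANY symmetric `ℤ`-lattice `(W, B)`, either sign `ε = ±1`,
any class `P` of isometries closed under composition and inverses and containing the `(2ε)`-reflections `σ_a`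
(`normTwoReflectionEquiv`), and any family `r : Fin N → W` of `(2ε)`-roots meeting every `P`-orbit of `(2ε)`-roots.
"`φ ≡ ρ` modulo `[P, P]`" is rendered as "`φρ⁻¹` is a word in commutators `[α, β]`, `α, β ∈ P`" (as in rows g50-#2/#3/#6/#9),
and the order of the abelianisation `P^{ab}` as the number of classes of `{φ // P φ}` under this relation (row g50-#6).
Written for lane `lit-hodgefound` (Track 2 foundations; prover seat `lit-hodgefound-p18`, gen 51, row g51-#1).
THEOREMS ONLY — no definition, no named fact, no instance, no notation.

## Source, verbatim (held `paper:arxiv-0810.1614`, p. 3)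

"**Theorem 1.3** Let `L` be a lattice which satisfies the Kneser conditions. Then `Õ⁺(L)^{ab}` (resp. `S̃O⁺(L)^{ab}`) is an
abelian `2`-group. Its order divides `2^N` (resp. `2^{N−1}`), where `N` is the number of different `Õ⁺(L)`-orbits (resp.
`S̃O⁺(L)`-orbits) of `(−2)`-vectors in `L`. *Proof.* For roots `a, b ∈ L` we write `a ≡ b mod Õ⁺(L)` if there exists
`g ∈ Õ⁺(L)` such that `g(a) = b`. In this case `σ_{g(a)} = gσ_ag⁻¹` and `σ_aσ_b ∈ [Õ⁺(L), Õ⁺(L)]`. By Theorem 1.1, any element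
of `S̃O⁺(L)` is a product of reflections by `(−2)`-vectors, and since `L` represents `−2` the same is true for `Õ⁺(L)`. Using
this, and the evident property `σ_uσ_v = σ_{σ_u(v)}σ_u`, we can rewrite any class modulo commutator as the class of a product
`σ_{a_1}⋯σ_{a_n}`, where the `(−2)`-vectors `a_i` all belong to different `Õ⁺(L)`-orbits. The square of such a class can be
written as the class of a product of elements `σ_{b_i}σ_{c_i}` where `b_i ≡ c_i mod Õ⁺(L)`, so it belongs to the commutator."
Application printed on p. 4: "there are at most two `Õ⁺(L_{2d})`-orbits of `(−2)`-vectors in `L_{2d}` [GHSorth]. Hence by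
Theorem 1.3 the order of `Õ⁺(L_{2d})^{ab}` divides `4`."

## What is formalized, and how (all proved)

The Kneser input "every element of the group is a product of reflections" (Thm. 1.1) is a HYPOTHESIS `hgen` of the counting
statement (the tree has it for `L ≅ U^{⊕n}`, `n ≥ 3`, row g49-#15 `hyperbolicSum_isWordIn_negTwoReflections_iff`, used in
§4); the rewriting statements (A), (C) need no generation hypothesis. Modulo commutator words the reflections COMMUTE
(`αβ(βα)⁻¹ = [β⁻¹, α⁻¹]`), so instead of the printed left-to-right rewriting by `σ_uσ_v = σ_{σ_u(v)}σ_u` (proved in row g50-#9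
as `normTwoReflectionEquiv_apply_normTwoReflectionEquiv_apply`) the letters are sorted directly: this is the same class
computation in the abelian group `P^{ab}`.
* §1 Classes modulo `[P, P]`-words: the relation "`φρ⁻¹` is a commutator word" is reflexive, symmetric, transitive, stable under
  right multiplication and under left multiplication by elements of `P`; `P^{ab}` is abelian (`αβ ≡ βα`).
* §2 Words in involutions `σ_i ∈ P` (`i : ι`): a letter moves to the front, a doubled letter cancels, a word in which every
  letter occurs an EVEN number of times is a commutator word, two words with the same letter parities are equivalent.
* §3 **Thm. 1.3**: `σ_{g(r)} ≡ σ_r` (`g ∈ P`; from row g50-#9's `σ_rσ_{g(r)} = [g, σ_r]`); **(A)** every word in the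
  `(2ε)`-reflections is equivalent to the ordered product of the `σ_{r_i}` over a SUBLIST of `[0, …, N−1]`
  (`exists_sublist_finRange_isWordIn_commutators_reflectionWord`: "a product `σ_{a_1}⋯σ_{a_n}` of representatives of
  different orbits"); **(C)** the square of every reflection word is a commutator word ("an abelian 2-group":
  `isWordIn_commutators_trans_self_of_isWordIn_reflections`); **(B)** if every element of `P` is a reflection word then the
  number of classes of `P` modulo `[P, P]`-words DIVIDES `2^N` (`natCard_quot_commutators_dvd_two_pow`: the classes of the
  `2^N` sublist-products form the image of a map from `(ℤ/2ℤ)^N` whose fibres are the cosets of a subgroup — Lagrange), hence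
  is `≤ 2^N`; one orbit: divides `2`.
* §4 Instances with `P = O⁺(L)`, `ε = −1`: every symmetric even unimodular lattice with `n± ≥ 2` has ONE `O⁺`-orbit of
  `(−2)`-vectors (GHS 2008 Prop. 2.4 (i), `LatticeFormsNegTwoVectorOrbitsOriented`), so under the Kneser hypothesis
  `O⁺(L) = ⟨σ_a⟩` the abelianisation `O⁺(L)^{ab}` has order dividing `2`; unconditionally for `U^{⊕n}`, `n ≥ 3` (where row
  g50-#6 computed the order to be exactly `2`: Thm. 1.3's bound is attained).

NOT formalized here: the clause "resp. `S̃O⁺(L)^{ab}` […] divides `2^{N−1}`" — the printed sentence "exactly the same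
argument works for `S̃O⁺(L)`" rewrites with `σ_{g(a)} = gσ_ag⁻¹`, `σ_a ∉ SO(L)`, i.e. modulo commutators taken in the
larger group; the tree has the conclusion `S̃O⁺(L)^{ab} = 1` for `L ≅ U^{⊕n}` by Eichler transvections (rows g50-#2/#3/#6).
-/

noncomputable section

open Module
open LinearMap (BilinForm)
open LinearMap.BilinForm
open LinearMap.BilinForm (IsometryEquiv)

namespace Literature.Topology.FourManifolds

universe u

/-! ### §1 Classes modulo commutator words of a class `P` of isometries -/

section Relation

variable {W : Type*} [AddCommGroup W] {B : BilinForm ℤ W} {P : B.IsometryEquiv B → Prop}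

/-- `(φρ)⁻¹ = ρ⁻¹φ⁻¹` pointwise (plumbing). [cite: GritsenkoHulekSankaran2009, Thm. 1.3 (proof)] -/
theorem IsometryEquiv.trans_symm_apply_eq (φ ρ : B.IsometryEquiv B) (v : W) : (φ.trans ρ).symm v = φ.symm (ρ.symm v) := rfl

/-- **`φ ≡ φ mod [P, P]`**: `φφ⁻¹ = 1` is the empty commutator word. [cite: GritsenkoHulekSankaran2009, Thm. 1.3 (proof: "class modulo commutator")] -/
theorem isWordIn_commutators_trans_self_symm (φ : B.IsometryEquiv B) :
    IsWordIn {ψ : B.IsometryEquiv B | ∃ α β : B.IsometryEquiv B, P α ∧ P β ∧ ψ = ((β.symm.trans α.symm).trans β).trans α}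
      (φ.trans φ.symm) :=
  IsWordIn.refl.congr fun v ↦ (LinearMap.BilinForm.IsometryEquiv.symm_apply_apply φ v).symm

/-- **Symmetry of `≡ mod [P, P]`**: if `φρ⁻¹` is a commutator word, so is `ρφ⁻¹ = (φρ⁻¹)⁻¹`.
[cite: GritsenkoHulekSankaran2009, Thm. 1.3 (proof: "class modulo commutator")] -/
theorem IsWordIn.commutators_rel_symm {φ ρ : B.IsometryEquiv B}
    (h : IsWordIn {ψ : B.IsometryEquiv B | ∃ α β : B.IsometryEquiv B, P α ∧ P β ∧ ψ = ((β.symm.trans α.symm).trans β).trans α}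
      (φ.trans ρ.symm)) :
    IsWordIn {ψ : B.IsometryEquiv B | ∃ α β : B.IsometryEquiv B, P α ∧ P β ∧ ψ = ((β.symm.trans α.symm).trans β).trans α}
      (ρ.trans φ.symm) :=
  h.symm.congr fun _ ↦ rfl

/-- **Transitivity of `≡ mod [P, P]`**: `φχ⁻¹ = (φρ⁻¹)(ρχ⁻¹)`. [cite: GritsenkoHulekSankaran2009, Thm. 1.3 (proof: "class modulo commutator")] -/
theorem IsWordIn.commutators_rel_trans {φ ρ χ : B.IsometryEquiv B}
    (h₁ : IsWordIn {ψ : B.IsometryEquiv B | ∃ α β : B.IsometryEquiv B, P α ∧ P β ∧ ψ = ((β.symm.trans α.symm).trans β).trans α}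
      (φ.trans ρ.symm))
    (h₂ : IsWordIn {ψ : B.IsometryEquiv B | ∃ α β : B.IsometryEquiv B, P α ∧ P β ∧ ψ = ((β.symm.trans α.symm).trans β).trans α}
      (ρ.trans χ.symm)) :
    IsWordIn {ψ : B.IsometryEquiv B | ∃ α β : B.IsometryEquiv B, P α ∧ P β ∧ ψ = ((β.symm.trans α.symm).trans β).trans α}
      (φ.trans χ.symm) :=
  (h₁.trans h₂).congr fun v ↦ by
    simp only [LinearMap.BilinForm.IsometryEquiv.trans_apply, LinearMap.BilinForm.IsometryEquiv.apply_symm_apply]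

/-- **`φ ≡ ρ ⟹ φχ ≡ ρχ`** (any `χ`): `(φχ)(ρχ)⁻¹ = φρ⁻¹`. [cite: GritsenkoHulekSankaran2009, Thm. 1.3 (proof)] -/
theorem IsWordIn.commutators_rel_trans_right {φ ρ : B.IsometryEquiv B}
    (h : IsWordIn {ψ : B.IsometryEquiv B | ∃ α β : B.IsometryEquiv B, P α ∧ P β ∧ ψ = ((β.symm.trans α.symm).trans β).trans α}
      (φ.trans ρ.symm)) (χ : B.IsometryEquiv B) :
    IsWordIn {ψ : B.IsometryEquiv B | ∃ α β : B.IsometryEquiv B, P α ∧ P β ∧ ψ = ((β.symm.trans α.symm).trans β).trans α}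
      ((φ.trans χ).trans (ρ.trans χ).symm) :=
  h.congr fun v ↦ by
    change ρ.symm (φ v) = ρ.symm (χ.symm (χ (φ v)))
    rw [LinearMap.BilinForm.IsometryEquiv.symm_apply_apply]

/-- **`φ ≡ ρ ⟹ χφ ≡ χρ` for `χ ∈ P`** (`P` closed under composition and inverses): `(χφ)(χρ)⁻¹ = χ(φρ⁻¹)χ⁻¹` and
`χ[α,β]χ⁻¹ = [χαχ⁻¹, χβχ⁻¹]`. [cite: GritsenkoHulekSankaran2009, Thm. 1.3 (proof) and §3.1 (t4)] -/
theorem IsWordIn.commutators_rel_trans_left (htrans : ∀ α β : B.IsometryEquiv B, P α → P β → P (α.trans β))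
    (hsymm : ∀ α : B.IsometryEquiv B, P α → P α.symm) {φ ρ : B.IsometryEquiv B}
    (h : IsWordIn {ψ : B.IsometryEquiv B | ∃ α β : B.IsometryEquiv B, P α ∧ P β ∧ ψ = ((β.symm.trans α.symm).trans β).trans α}
      (φ.trans ρ.symm)) {χ : B.IsometryEquiv B} (hχ : P χ) :
    IsWordIn {ψ : B.IsometryEquiv B | ∃ α β : B.IsometryEquiv B, P α ∧ P β ∧ ψ = ((β.symm.trans α.symm).trans β).trans α}
      ((χ.trans φ).trans (χ.trans ρ).symm) :=
  (h.commutators_conj_of (P' := P) χ.symm fun _ hα ↦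
      htrans _ _ (hsymm _ (hsymm _ hχ)) (htrans _ _ hα (hsymm _ hχ))).congr fun _ ↦ rfl

/-- **`P^{ab}` is abelian: `αβ ≡ βα mod [P, P]`** for `α, β ∈ P` — `(αβ)(βα)⁻¹ = αβα⁻¹β⁻¹ = [β⁻¹, α⁻¹]` is a commutator of
elements of `P`. [cite: GritsenkoHulekSankaran2009, Thm. 1.3 ("Õ⁺(L)^{ab} […] is an abelian 2-group")] -/
theorem isWordIn_commutators_trans_trans_trans_symm (hsymm : ∀ α : B.IsometryEquiv B, P α → P α.symm) {α β : B.IsometryEquiv B}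
    (hα : P α) (hβ : P β) :
    IsWordIn {ψ : B.IsometryEquiv B | ∃ α β : B.IsometryEquiv B, P α ∧ P β ∧ ψ = ((β.symm.trans α.symm).trans β).trans α}
      ((α.trans β).trans (β.trans α).symm) :=
  (IsWordIn.of_mem (S := {ψ : B.IsometryEquiv B | ∃ α β : B.IsometryEquiv B, P α ∧ P β ∧
      ψ = ((β.symm.trans α.symm).trans β).trans α}) ⟨β.symm, α.symm, hsymm _ hβ, hsymm _ hα, rfl⟩).congr fun _ ↦ rfl

/-- **Equivalent isometries lie in `[P, P]`-words together**: if `φρ⁻¹` is a commutator word then `φ` is one iff `ρ` is one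
(`φ = (φρ⁻¹)ρ`, `ρ = (φρ⁻¹)⁻¹φ`). [cite: GritsenkoHulekSankaran2009, Thm. 1.3 (proof: "so it belongs to the commutator")] -/
theorem IsWordIn.commutators_iff_of_rel {φ ρ : B.IsometryEquiv B}
    (h : IsWordIn {ψ : B.IsometryEquiv B | ∃ α β : B.IsometryEquiv B, P α ∧ P β ∧ ψ = ((β.symm.trans α.symm).trans β).trans α}
      (φ.trans ρ.symm)) :
    IsWordIn {ψ : B.IsometryEquiv B | ∃ α β : B.IsometryEquiv B, P α ∧ P β ∧ ψ = ((β.symm.trans α.symm).trans β).trans α} φ ↔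
      IsWordIn {ψ : B.IsometryEquiv B | ∃ α β : B.IsometryEquiv B, P α ∧ P β ∧ ψ = ((β.symm.trans α.symm).trans β).trans α} ρ := by
  refine ⟨fun hφ ↦ (h.symm.trans hφ).congr fun v ↦ ?_, fun hρ ↦ (h.trans hρ).congr fun v ↦ ?_⟩
  · change φ (φ.symm (ρ v)) = ρ v
    rw [LinearMap.BilinForm.IsometryEquiv.apply_symm_apply]
  · simp only [LinearMap.BilinForm.IsometryEquiv.trans_apply, LinearMap.BilinForm.IsometryEquiv.apply_symm_apply]

/-- A product of members of `P` lies in `P` (`P ∋ 1` closed under composition). [cite: GritsenkoHulekSankaran2009, Thm. 1.3 (proof: "a product σ_{a_1}⋯σ_{a_n}")] -/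
theorem wordProd_prop_of_forall (h1 : P (LinearMap.BilinForm.IsometryEquiv.refl B))
    (htrans : ∀ α β : B.IsometryEquiv B, P α → P β → P (α.trans β)) {l : List (B.IsometryEquiv B)} (hl : ∀ s ∈ l, P s) :
    P (wordProd l) := by
  induction l with
  | nil => exact h1
  | cons s l ih =>
    rw [wordProd_cons]
    exact htrans _ _ (hl s List.mem_cons_self) (ih fun t ht ↦ hl t (List.mem_cons_of_mem s ht))

/-- **Letterwise equivalent words have equivalent products**: if `s_k ≡ t_k mod [P, P]` with `s_k ∈ P` for all `k`, then
`s_1⋯s_n ≡ t_1⋯t_n`. [cite: GritsenkoHulekSankaran2009, Thm. 1.3 (proof: "we can rewrite any class modulo commutator as the class of a product")] -/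
theorem isWordIn_commutators_wordProd_trans_wordProd_symm_of_forall₂
    (htrans : ∀ α β : B.IsometryEquiv B, P α → P β → P (α.trans β)) (hsymm : ∀ α : B.IsometryEquiv B, P α → P α.symm)
    {l₁ l₂ : List (B.IsometryEquiv B)}
    (h : List.Forall₂ (fun s t ↦ P s ∧ IsWordIn {ψ : B.IsometryEquiv B | ∃ α β : B.IsometryEquiv B, P α ∧ P β ∧
      ψ = ((β.symm.trans α.symm).trans β).trans α} (s.trans t.symm)) l₁ l₂) :
    IsWordIn {ψ : B.IsometryEquiv B | ∃ α β : B.IsometryEquiv B, P α ∧ P β ∧ ψ = ((β.symm.trans α.symm).trans β).trans α}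
      ((wordProd l₁).trans (wordProd l₂).symm) := by
  induction h with
  | nil => exact isWordIn_commutators_trans_self_symm _
  | cons hst _ ih =>
    rw [wordProd_cons, wordProd_cons]
    exact (ih.commutators_rel_trans_left htrans hsymm hst.1).commutators_rel_trans (hst.2.commutators_rel_trans_right _)

end Relation

/-! ### §2 Words in involutions from `P`, modulo commutator words -/

section Involutions

variable {W : Type*} [AddCommGroup W] {B : BilinForm ℤ W} {P : B.IsometryEquiv B → Prop} {ι : Type*}
  {σ : ι → B.IsometryEquiv B}

/-- For involutions `σ_i`, the reversed word undoes the word: `σ_{i_n}⋯σ_{i_1}(σ_{i_1}⋯σ_{i_n} w) = w` (here in the tree's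
diagrammatic convention). [cite: GritsenkoHulekSankaran2009, Thm. 1.3 (proof: reflections σ_a, σ_a² = 1)] -/
theorem wordProd_reverse_wordProd_apply_of_involutive (hσσ : ∀ i v, σ i (σ i v) = v) (l : List ι) (w : W) :
    wordProd ((l.map σ).reverse) (wordProd (l.map σ) w) = w := by
  induction l generalizing w with
  | nil => rfl
  | cons a l ih =>
    rw [List.map_cons, List.reverse_cons, wordProd_cons, LinearMap.BilinForm.IsometryEquiv.trans_apply, wordProd_append_apply,
      ih, wordProd_cons, wordProd_nil, LinearMap.BilinForm.IsometryEquiv.trans_apply,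
      LinearMap.BilinForm.IsometryEquiv.refl_apply, hσσ]

/-- For involutions, **the inverse of a word is the reversed word**: `(σ_{i_1}⋯σ_{i_n})⁻¹ = σ_{i_n}⋯σ_{i_1}` pointwise.
[cite: GritsenkoHulekSankaran2009, Thm. 1.3 (proof)] -/
theorem wordProd_reverse_apply_of_involutive (hσσ : ∀ i v, σ i (σ i v) = v) (l : List ι) (x : W) :
    wordProd ((l.map σ).reverse) x = (wordProd (l.map σ)).symm x := by
  have h := wordProd_reverse_wordProd_apply_of_involutive hσσ l ((wordProd (l.map σ)).symm x)
  rwa [LinearMap.BilinForm.IsometryEquiv.apply_symm_apply] at h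

/-- `(σ_{l₁})(σ_{l₂})⁻¹ = σ_{l₁ ⧺ reverse l₂}` pointwise, for involutions. [cite: GritsenkoHulekSankaran2009, Thm. 1.3 (proof)] -/
theorem wordProd_trans_wordProd_symm_apply_of_involutive (hσσ : ∀ i v, σ i (σ i v) = v) (l₁ l₂ : List ι) (w : W) :
    ((wordProd (l₁.map σ)).trans (wordProd (l₂.map σ)).symm) w = wordProd ((l₁ ++ l₂.reverse).map σ) w := by
  rw [List.map_append, wordProd_append_apply, List.map_reverse, LinearMap.BilinForm.IsometryEquiv.trans_apply,
    wordProd_reverse_apply_of_involutive hσσ]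

/-- **A letter moves to the front modulo `[P, P]`**: `σ_{u} σ_a σ_{v} ≡ σ_a σ_{u} σ_{v}` for letters in `P` (the classes
commute). [cite: GritsenkoHulekSankaran2009, Thm. 1.3 (proof: "we can rewrite any class modulo commutator")] -/
theorem isWordIn_commutators_wordProd_append_cons_rel (htrans : ∀ α β : B.IsometryEquiv B, P α → P β → P (α.trans β))
    (hsymm : ∀ α : B.IsometryEquiv B, P α → P α.symm) (hσP : ∀ i, P (σ i)) (u v : List ι) (a : ι) :
    IsWordIn {ψ : B.IsometryEquiv B | ∃ α β : B.IsometryEquiv B, P α ∧ P β ∧ ψ = ((β.symm.trans α.symm).trans β).trans α}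
      ((wordProd ((u ++ a :: v).map σ)).trans (wordProd ((a :: (u ++ v)).map σ)).symm) := by
  induction u with
  | nil => exact isWordIn_commutators_trans_self_symm _
  | cons b u ih =>
    have h1 : IsWordIn {ψ : B.IsometryEquiv B | ∃ α β : B.IsometryEquiv B, P α ∧ P β ∧ ψ = ((β.symm.trans α.symm).trans β).trans α}
        (((σ b).trans (wordProd ((u ++ a :: v).map σ))).trans ((σ b).trans ((σ a).trans (wordProd ((u ++ v).map σ)))).symm) :=
      (ih.commutators_rel_trans_left htrans hsymm (hσP b)).congr fun _ ↦ rfl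
    have h2 : IsWordIn {ψ : B.IsometryEquiv B | ∃ α β : B.IsometryEquiv B, P α ∧ P β ∧ ψ = ((β.symm.trans α.symm).trans β).trans α}
        (((σ b).trans ((σ a).trans (wordProd ((u ++ v).map σ)))).trans ((σ a).trans ((σ b).trans (wordProd ((u ++ v).map σ)))).symm) :=
      ((isWordIn_commutators_trans_trans_trans_symm hsymm (hσP b) (hσP a)).commutators_rel_trans_right
        (wordProd ((u ++ v).map σ))).congr fun _ ↦ rfl
    exact (h1.commutators_rel_trans h2).congr fun _ ↦ rfl

/-- **A doubled letter cancels**: `σ_a σ_a σ_{l} = σ_{l}` pointwise (involutions), in particular modulo `[P, P]`.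
[cite: GritsenkoHulekSankaran2009, Thm. 1.3 (proof: "The square of such a class")] -/
theorem isWordIn_commutators_wordProd_cons_cons_rel (hσσ : ∀ i v, σ i (σ i v) = v) (l : List ι) (a : ι) :
    IsWordIn {ψ : B.IsometryEquiv B | ∃ α β : B.IsometryEquiv B, P α ∧ P β ∧ ψ = ((β.symm.trans α.symm).trans β).trans α}
      ((wordProd ((a :: a :: l).map σ)).trans (wordProd (l.map σ)).symm) :=
  IsWordIn.refl.congr fun w ↦ by
    simp only [List.map_cons, wordProd_cons, LinearMap.BilinForm.IsometryEquiv.trans_apply,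
      LinearMap.BilinForm.IsometryEquiv.refl_apply, hσσ, LinearMap.BilinForm.IsometryEquiv.symm_apply_apply]

/-- **Even-count words are commutator words**: a word in involutions `σ_i ∈ P` in which every letter occurs an even number of
times is a word in commutators of elements of `P` ("the square of such a class […] belongs to the commutator"; by induction:
move the second occurrence of the first letter to the front and cancel). [cite: GritsenkoHulekSankaran2009, Thm. 1.3 (proof)] -/
theorem isWordIn_commutators_wordProd_of_forall_even_count [BEq ι] [LawfulBEq ι]
    (htrans : ∀ α β : B.IsometryEquiv B, P α → P β → P (α.trans β)) (hsymm : ∀ α : B.IsometryEquiv B, P α → P α.symm)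
    (hσP : ∀ i, P (σ i)) (hσσ : ∀ i v, σ i (σ i v) = v) (l : List ι) (hl : ∀ i, Even (l.count i)) :
    IsWordIn {ψ : B.IsometryEquiv B | ∃ α β : B.IsometryEquiv B, P α ∧ P β ∧ ψ = ((β.symm.trans α.symm).trans β).trans α}
      (wordProd (l.map σ)) := by
  obtain ⟨n, hn⟩ : ∃ n, l.length ≤ n := ⟨l.length, le_rfl⟩
  induction n generalizing l with
  | zero =>
    obtain rfl := List.eq_nil_of_length_eq_zero (Nat.le_zero.1 hn)
    exact IsWordIn.refl
  | succ n ih =>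
    cases l with
    | nil => exact IsWordIn.refl
    | cons a l =>
      have ha : a ∈ l := by
        have h := hl a
        rw [List.count_cons_self, Nat.even_add_one] at h
        exact List.count_pos_iff.1 (Nat.pos_of_ne_zero fun h0 ↦ h (by rw [h0]; exact ⟨0, rfl⟩))
      obtain ⟨s, t, rfl⟩ := List.append_of_mem ha
      have hlen : (s ++ t).length ≤ n := by
        simp only [List.length_cons, List.length_append] at hn ⊢
        omega
      have hl' : ∀ i, Even ((s ++ t).count i) := fun i ↦ by
        have h2 : (a :: (s ++ a :: t)).count i = (s ++ t).count i + 2 * [a].count i := by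
          simp only [List.count_cons, List.count_append, List.count_nil]
          ring
        have h := hl i
        rw [h2] at h
        exact (Nat.even_add.1 h).2 (even_two_mul _)
      have h1 : IsWordIn {ψ : B.IsometryEquiv B | ∃ α β : B.IsometryEquiv B, P α ∧ P β ∧ ψ = ((β.symm.trans α.symm).trans β).trans α}
          ((wordProd ((a :: (s ++ a :: t)).map σ)).trans (wordProd ((a :: a :: (s ++ t)).map σ)).symm) :=
        ((isWordIn_commutators_wordProd_append_cons_rel htrans hsymm hσP s t a).commutators_rel_trans_left htrans hsymm
          (hσP a)).congr fun _ ↦ rfl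
      exact (IsWordIn.commutators_iff_of_rel (h1.commutators_rel_trans (isWordIn_commutators_wordProd_cons_cons_rel hσσ _ a))).2
        (ih (s ++ t) hl' hlen)

/-- **Words with the same letter parities are equivalent modulo `[P, P]`** (involutions `σ_i ∈ P`): if every letter occurs
in `l₁` and `l₂` with the same parity then `σ_{l₁}σ_{l₂}⁻¹ = σ_{l₁ ⧺ reverse l₂}` is an even-count word.
[cite: GritsenkoHulekSankaran2009, Thm. 1.3 (proof: "rewrite any class […] as the class of a product σ_{a_1}⋯σ_{a_n} […] different orbits")] -/
theorem isWordIn_commutators_wordProd_trans_wordProd_symm_of_forall_even [BEq ι] [LawfulBEq ι]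
    (htrans : ∀ α β : B.IsometryEquiv B, P α → P β → P (α.trans β)) (hsymm : ∀ α : B.IsometryEquiv B, P α → P α.symm)
    (hσP : ∀ i, P (σ i)) (hσσ : ∀ i v, σ i (σ i v) = v) (l₁ l₂ : List ι) (h : ∀ i, Even (l₁.count i + l₂.count i)) :
    IsWordIn {ψ : B.IsometryEquiv B | ∃ α β : B.IsometryEquiv B, P α ∧ P β ∧ ψ = ((β.symm.trans α.symm).trans β).trans α}
      ((wordProd (l₁.map σ)).trans (wordProd (l₂.map σ)).symm) :=
  (isWordIn_commutators_wordProd_of_forall_even_count htrans hsymm hσP hσσ (l₁ ++ l₂.reverse) fun i ↦ by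
      rw [List.count_append, List.count_reverse]
      exact h i).congr fun w ↦ (wordProd_trans_wordProd_symm_apply_of_involutive hσσ l₁ l₂ w).symm

/-- Under the same parity hypothesis, `σ_{l₁}` is a commutator word iff `σ_{l₂}` is. [cite: GritsenkoHulekSankaran2009, Thm. 1.3 (proof)] -/
theorem isWordIn_commutators_wordProd_iff_of_forall_even [BEq ι] [LawfulBEq ι]
    (htrans : ∀ α β : B.IsometryEquiv B, P α → P β → P (α.trans β)) (hsymm : ∀ α : B.IsometryEquiv B, P α → P α.symm)
    (hσP : ∀ i, P (σ i)) (hσσ : ∀ i v, σ i (σ i v) = v) (l₁ l₂ : List ι) (h : ∀ i, Even (l₁.count i + l₂.count i)) :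
    IsWordIn {ψ : B.IsometryEquiv B | ∃ α β : B.IsometryEquiv B, P α ∧ P β ∧ ψ = ((β.symm.trans α.symm).trans β).trans α}
        (wordProd (l₁.map σ)) ↔
      IsWordIn {ψ : B.IsometryEquiv B | ∃ α β : B.IsometryEquiv B, P α ∧ P β ∧ ψ = ((β.symm.trans α.symm).trans β).trans α}
        (wordProd (l₂.map σ)) :=
  (isWordIn_commutators_wordProd_trans_wordProd_symm_of_forall_even htrans hsymm hσP hσσ l₁ l₂ h).commutators_iff_of_rel

/-- Counting letters of a sub-word of `[0, …, N−1]` cut out by a predicate: `0` or `1`. [cite: GritsenkoHulekSankaran2009, Thm. 1.3 (proof: "all belong to different orbits")] -/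
theorem count_filter_finRange {N : ℕ} (p : Fin N → Bool) (i : Fin N) :
    ((List.finRange N).filter p).count i = if p i then 1 else 0 := by
  by_cases h : p i
  · rw [if_pos h, List.count_filter h]
    exact List.count_eq_one_of_mem (List.nodup_finRange N) (List.mem_finRange i)
  · rw [if_neg h]
    exact List.count_eq_zero.2 fun hm ↦ h (List.mem_filter.1 hm).2

end Involutions

/-! ### §3 Theorem 1.3: reflections, orbit representatives, the order of the abelianisation -/

section Reflections

variable {W : Type*} [AddCommGroup W] {B : BilinForm ℤ W} {P : B.IsometryEquiv B → Prop}

/-- **"`a ≡ b mod Õ⁺(L)` ⟹ `σ_aσ_b ∈ [Õ⁺(L), Õ⁺(L)]`", class form: `σ_{g(r)} ≡ σ_r mod [P, P]`** for `g ∈ P` (`σ_r ∈ P`):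
`σ_{g(r)}σ_r⁻¹ = σ_{g(r)}σ_r = (σ_rσ_{g(r)})⁻¹ = [g, σ_r]⁻¹` (row g50-#9). [cite: GritsenkoHulekSankaran2009, Thm. 1.3 (proof: "σ_{g(a)} = gσ_ag⁻¹")] -/
theorem isWordIn_commutators_reflection_trans_reflection_symm_of_apply_eq (hB : B.IsSymm) {ε : ℤ} (hε : ε * ε = 1)
    (hP : ∀ (a : W) (ha : B a a = ε + ε), P (normTwoReflectionEquiv hB a ε ha hε)) {g : B.IsometryEquiv B} (hg : P g)
    {r a : W} (hr : B r r = ε + ε) (ha : B a a = ε + ε) (hga : g r = a) :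
    IsWordIn {ψ : B.IsometryEquiv B | ∃ α β : B.IsometryEquiv B, P α ∧ P β ∧ ψ = ((β.symm.trans α.symm).trans β).trans α}
      ((normTwoReflectionEquiv hB a ε ha hε).trans (normTwoReflectionEquiv hB r ε hr hε).symm) := by
  subst hga
  refine (isWordIn_commutators_normTwoReflectionEquiv_trans_map_of hB hr hε g ha hg (hP r hr)).symm.congr fun v ↦ ?_
  change (normTwoReflectionEquiv hB r ε hr hε).symm ((normTwoReflectionEquiv hB (g r) ε ha hε).symm v) =
    (normTwoReflectionEquiv hB r ε hr hε).symm (normTwoReflectionEquiv hB (g r) ε ha hε v)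
  rw [normTwoReflectionEquiv_symm hB (g r)]

/-- Choosing, letter by letter, a related partner (plumbing for "choose an orbit representative for each `a_k`").
[cite: GritsenkoHulekSankaran2009, Thm. 1.3 (proof)] -/
theorem exists_forall₂_of_forall_mem_exists {α β : Type*} {R : α → β → Prop} :
    ∀ l : List α, (∀ a ∈ l, ∃ b, R a b) → ∃ l' : List β, List.Forall₂ R l l'
  | [], _ => ⟨[], List.Forall₂.nil⟩
  | a :: l, h => by
    obtain ⟨b, hb⟩ := h a List.mem_cons_self
    obtain ⟨l', hl'⟩ := exists_forall₂_of_forall_mem_exists l fun x hx ↦ h x (List.mem_cons_of_mem a hx)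
    exact ⟨b :: l', List.Forall₂.cons hb hl'⟩

/-- A list all of whose members are values of `σ` is a mapped list (plumbing). [cite: GritsenkoHulekSankaran2009, Thm. 1.3 (proof: "a product of reflections")] -/
theorem exists_eq_map_of_forall_mem_exists {α β : Type*} (f : β → α) :
    ∀ l : List α, (∀ a ∈ l, ∃ b, a = f b) → ∃ l' : List β, l = l'.map f
  | [], _ => ⟨[], rfl⟩
  | a :: l, h => by
    obtain ⟨b, rfl⟩ := h a List.mem_cons_self
    obtain ⟨l', rfl⟩ := exists_eq_map_of_forall_mem_exists f l fun x hx ↦ h x (List.mem_cons_of_mem _ hx)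
    exact ⟨b :: l', rfl⟩

/-- **Theorem 1.3, the rewriting (A): "we can rewrite any class modulo commutator as the class of a product `σ_{a_1}⋯σ_{a_n}`,
where the `(−2)`-vectors `a_i` all belong to different orbits"** — for any symmetric lattice, sign `ε = ±1`, class `P` of
isometries closed under composition and inverses containing the `(2ε)`-reflections, and `(2ε)`-roots `r_0, …, r_{N−1}`
meeting every `P`-orbit of `(2ε)`-roots: every word `φ` in the `(2ε)`-reflections satisfies `φ ≡ σ_{r_{i_1}}⋯σ_{r_{i_k}}`
modulo `[P, P]`-words for a SUBLIST `i_1 < ⋯ < i_k` of `[0, …, N−1]`. [cite: GritsenkoHulekSankaran2009, Thm. 1.3 (proof)] -/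
theorem exists_sublist_finRange_isWordIn_commutators_reflectionWord (hB : B.IsSymm) {ε : ℤ} (hε : ε * ε = 1)
    (htrans : ∀ α β : B.IsometryEquiv B, P α → P β → P (α.trans β)) (hsymm : ∀ α : B.IsometryEquiv B, P α → P α.symm)
    (hP : ∀ (a : W) (ha : B a a = ε + ε), P (normTwoReflectionEquiv hB a ε ha hε)) {N : ℕ} (r : Fin N → W)
    (hr : ∀ i, B (r i) (r i) = ε + ε) (horbit : ∀ a : W, B a a = ε + ε → ∃ (i : Fin N) (g : B.IsometryEquiv B), P g ∧ g (r i) = a)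
    {φ : B.IsometryEquiv B}
    (hφ : IsWordIn {ψ : B.IsometryEquiv B | ∃ (a : W) (ha : B a a = ε + ε), ψ = normTwoReflectionEquiv hB a ε ha hε} φ) :
    ∃ l : List (Fin N), List.Sublist l (List.finRange N) ∧
      IsWordIn {ψ : B.IsometryEquiv B | ∃ α β : B.IsometryEquiv B, P α ∧ P β ∧ ψ = ((β.symm.trans α.symm).trans β).trans α}
        (φ.trans (wordProd (l.map fun i ↦ normTwoReflectionEquiv hB (r i) ε (hr i) hε)).symm) := by
  classical
  obtain ⟨L, hL, hLφ⟩ := hφ.exists_list_of_symm_mem fun s hs ↦ by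
    obtain ⟨a, ha, rfl⟩ := hs
    exact ⟨a, ha, normTwoReflectionEquiv_symm hB a ε ha hε⟩
  -- an orbit representative for each letter
  obtain ⟨js, hjs⟩ := exists_forall₂_of_forall_mem_exists (R := fun s (j : Fin N) ↦ P s ∧
      IsWordIn {ψ : B.IsometryEquiv B | ∃ α β : B.IsometryEquiv B, P α ∧ P β ∧ ψ = ((β.symm.trans α.symm).trans β).trans α}
        (s.trans (normTwoReflectionEquiv hB (r j) ε (hr j) hε).symm)) L fun s hs ↦ by
    obtain ⟨a, ha, rfl⟩ := hL s hs
    obtain ⟨i, g, hg, hga⟩ := horbit a ha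
    exact ⟨i, hP a ha, isWordIn_commutators_reflection_trans_reflection_symm_of_apply_eq hB hε hP hg (hr i) ha hga⟩
  have h3 : IsWordIn {ψ : B.IsometryEquiv B | ∃ α β : B.IsometryEquiv B, P α ∧ P β ∧ ψ = ((β.symm.trans α.symm).trans β).trans α}
      ((wordProd L).trans (wordProd (js.map fun i ↦ normTwoReflectionEquiv hB (r i) ε (hr i) hε)).symm) := by
    have h := isWordIn_commutators_wordProd_trans_wordProd_symm_of_forall₂ htrans hsymm
      (List.forall₂_map_right_iff.2 hjs : List.Forall₂ (fun s t ↦ P s ∧ IsWordIn {ψ : B.IsometryEquiv B |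
        ∃ α β : B.IsometryEquiv B, P α ∧ P β ∧ ψ = ((β.symm.trans α.symm).trans β).trans α} (s.trans t.symm)) L
        (js.map fun i ↦ normTwoReflectionEquiv hB (r i) ε (hr i) hε))
    exact h
  -- sort the representatives: keep those occurring an odd number of times, in increasing order
  refine ⟨(List.finRange N).filter fun i ↦ decide (Odd (js.count i)), List.filter_sublist, ?_⟩
  have h4 := isWordIn_commutators_wordProd_trans_wordProd_symm_of_forall_even htrans hsymm (fun i ↦ hP (r i) (hr i))
    (fun i v ↦ normTwoReflectionEquiv_apply_apply hB (r i) ε (hr i) hε v) js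
    ((List.finRange N).filter fun i ↦ decide (Odd (js.count i))) fun i ↦ by
      rw [count_filter_finRange]
      by_cases ho : Odd (js.count i)
      · rw [if_pos (decide_eq_true ho)]
        exact ho.add_one
      · rw [if_neg (by simpa using ho), add_zero]
        exact Nat.not_odd_iff_even.1 ho
  exact (h3.commutators_rel_trans h4).congr fun v ↦ by
    simp only [LinearMap.BilinForm.IsometryEquiv.trans_apply, hLφ]

/-- **Theorem 1.3, "an abelian `2`-group" (C): the square of every class is trivial** — for every word `φ` in the
`(2ε)`-reflections (`⊆ P`), `φ²` is a word in commutators of elements of `P` ("The square of such a class can be written as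
the class of a product of elements `σ_{b_i}σ_{c_i}` where `b_i ≡ c_i` […], so it belongs to the commutator").
[cite: GritsenkoHulekSankaran2009, Thm. 1.3 (proof)] -/
theorem isWordIn_commutators_trans_self_of_isWordIn_reflections (hB : B.IsSymm) {ε : ℤ} (hε : ε * ε = 1)
    (htrans : ∀ α β : B.IsometryEquiv B, P α → P β → P (α.trans β)) (hsymm : ∀ α : B.IsometryEquiv B, P α → P α.symm)
    (hP : ∀ (a : W) (ha : B a a = ε + ε), P (normTwoReflectionEquiv hB a ε ha hε)) {φ : B.IsometryEquiv B}
    (hφ : IsWordIn {ψ : B.IsometryEquiv B | ∃ (a : W) (ha : B a a = ε + ε), ψ = normTwoReflectionEquiv hB a ε ha hε} φ) :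
    IsWordIn {ψ : B.IsometryEquiv B | ∃ α β : B.IsometryEquiv B, P α ∧ P β ∧ ψ = ((β.symm.trans α.symm).trans β).trans α}
      (φ.trans φ) := by
  classical
  obtain ⟨L, hL, hLφ⟩ := hφ.exists_list_of_symm_mem fun s hs ↦ by
    obtain ⟨a, ha, rfl⟩ := hs
    exact ⟨a, ha, normTwoReflectionEquiv_symm hB a ε ha hε⟩
  obtain ⟨L', rfl⟩ := exists_eq_map_of_forall_mem_exists
    (fun a : {a : W // B a a = ε + ε} ↦ normTwoReflectionEquiv hB a.1 ε a.2 hε) L fun s hs ↦ by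
    obtain ⟨a, ha, rfl⟩ := hL s hs
    exact ⟨⟨a, ha⟩, rfl⟩
  refine (isWordIn_commutators_wordProd_of_forall_even_count (σ := fun a : {a : W // B a a = ε + ε} ↦
      normTwoReflectionEquiv hB a.1 ε a.2 hε) htrans hsymm (fun a ↦ hP a.1 a.2)
    (fun a v ↦ normTwoReflectionEquiv_apply_apply hB a.1 ε a.2 hε v) (L' ++ L') fun i ↦ by
      rw [List.count_append]
      exact ⟨_, rfl⟩).congr fun v ↦ ?_
  rw [List.map_append, wordProd_append_apply, hLφ, hLφ, LinearMap.BilinForm.IsometryEquiv.trans_apply]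

/-- **Theorem 1.3, "an abelian `2`-group": the classes commute** — `φρ ≡ ρφ mod [P, P]` for all `φ, ρ ∈ P` (in particular for
reflection words). [cite: GritsenkoHulekSankaran2009, Thm. 1.3 ("is an abelian 2-group")] -/
theorem isWordIn_commutators_trans_trans_trans_symm_of (hsymm : ∀ α : B.IsometryEquiv B, P α → P α.symm)
    {φ ρ : B.IsometryEquiv B} (hφ : P φ) (hρ : P ρ) :
    IsWordIn {ψ : B.IsometryEquiv B | ∃ α β : B.IsometryEquiv B, P α ∧ P β ∧ ψ = ((β.symm.trans α.symm).trans β).trans α}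
      ((φ.trans ρ).trans (ρ.trans φ).symm) :=
  isWordIn_commutators_trans_trans_trans_symm hsymm hφ hρ

/-- **Theorem 1.3 (B): "Its order divides `2^N`, where `N` is the number of different orbits of `(−2)`-vectors"** — for any
symmetric lattice, sign `ε = ±1` and class `P ∋ 1` of isometries closed under composition and inverses, containing the
`(2ε)`-reflections and GENERATED by them (every element of `P` is a word in the `(2ε)`-reflections — Kneser's Thm. 1.1 in
the printed setting), if `(2ε)`-roots `r_0, …, r_{N−1}` meet every `P`-orbit of `(2ε)`-roots then the number of classes of
`P` modulo `[P, P]`-words (the order of `P^{ab}`) divides `2^N`: the classes of the `2^N` sublist-products `σ_{r_{i_1}}⋯σ_{r_{i_k}}`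
exhaust `P^{ab}`, and `(ℤ/2ℤ)^N → P^{ab}`, `x ↦ ∏_{x_i = 1} σ_{r_i}` has as fibres the cosets of a subgroup (Lagrange).
[cite: GritsenkoHulekSankaran2009, Thm. 1.3] -/
theorem natCard_quot_commutators_dvd_two_pow (hB : B.IsSymm) {ε : ℤ} (hε : ε * ε = 1)
    (h1 : P (LinearMap.BilinForm.IsometryEquiv.refl B)) (htrans : ∀ α β : B.IsometryEquiv B, P α → P β → P (α.trans β))
    (hsymm : ∀ α : B.IsometryEquiv B, P α → P α.symm) (hP : ∀ (a : W) (ha : B a a = ε + ε), P (normTwoReflectionEquiv hB a ε ha hε))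
    (hgen : ∀ φ : B.IsometryEquiv B, P φ →
      IsWordIn {ψ : B.IsometryEquiv B | ∃ (a : W) (ha : B a a = ε + ε), ψ = normTwoReflectionEquiv hB a ε ha hε} φ)
    {N : ℕ} (r : Fin N → W) (hr : ∀ i, B (r i) (r i) = ε + ε)
    (horbit : ∀ a : W, B a a = ε + ε → ∃ (i : Fin N) (g : B.IsometryEquiv B), P g ∧ g (r i) = a) :
    Nat.card (Quot fun φ ρ : {φ : B.IsometryEquiv B // P φ} ↦
      IsWordIn {ψ : B.IsometryEquiv B | ∃ α β : B.IsometryEquiv B, P α ∧ P β ∧ ψ = ((β.symm.trans α.symm).trans β).trans α}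
        (φ.1.trans ρ.1.symm)) ∣ 2 ^ N := by
  classical
  -- the reflections in the representatives, involutions in `P`
  have hσP : ∀ i : Fin N, P (normTwoReflectionEquiv hB (r i) ε (hr i) hε) := fun i ↦ hP (r i) (hr i)
  have hσσ : ∀ (i : Fin N) (v : W), normTwoReflectionEquiv hB (r i) ε (hr i) hε (normTwoReflectionEquiv hB (r i) ε (hr i) hε v) = v :=
    fun i v ↦ normTwoReflectionEquiv_apply_apply hB (r i) ε (hr i) hε v
  -- the sublist-product attached to a vector `x ∈ (ℤ/2ℤ)^N` lies in `P`
  have hPw : ∀ x : Fin N → ZMod 2, P (wordProd (((List.finRange N).filter fun i ↦ decide (x i = 1)).map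
      fun i ↦ normTwoReflectionEquiv hB (r i) ε (hr i) hε)) := fun x ↦
    wordProd_prop_of_forall h1 htrans fun s hs ↦ by
      obtain ⟨i, -, rfl⟩ := List.mem_map.1 hs
      exact hσP i
  -- the relation is an equivalence relation
  have hequiv : Equivalence fun φ ρ : {φ : B.IsometryEquiv B // P φ} ↦
      IsWordIn {ψ : B.IsometryEquiv B | ∃ α β : B.IsometryEquiv B, P α ∧ P β ∧ ψ = ((β.symm.trans α.symm).trans β).trans α}
        (φ.1.trans ρ.1.symm) :=
    ⟨fun φ ↦ isWordIn_commutators_trans_self_symm φ.1, fun h ↦ h.commutators_rel_symm, fun h₁ h₂ ↦ h₁.commutators_rel_trans h₂⟩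
  -- letter counts of the sublist attached to `x`
  have hcount : ∀ (x : Fin N → ZMod 2) (i : Fin N),
      ((List.finRange N).filter fun i ↦ decide (x i = 1)).count i = if x i = 1 then 1 else 0 := fun x i ↦ by
    rw [count_filter_finRange]
    by_cases hx : x i = 1
    · rw [if_pos (decide_eq_true hx), if_pos hx]
    · rw [if_neg (by simpa using hx), if_neg hx]
  have key : ∀ a b : ZMod 2,
      Even ((if a = 1 then 1 else 0) + (if b = 1 then 1 else 0) + (if a + b = 1 then 1 else 0) : ℕ) := by decide
  -- two vectors give the same class iff their sum gives the trivial class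
  have hkey : ∀ x y : Fin N → ZMod 2,
      Quot.mk (fun φ ρ : {φ : B.IsometryEquiv B // P φ} ↦
          IsWordIn {ψ : B.IsometryEquiv B | ∃ α β : B.IsometryEquiv B, P α ∧ P β ∧ ψ = ((β.symm.trans α.symm).trans β).trans α}
            (φ.1.trans ρ.1.symm))
          ⟨wordProd (((List.finRange N).filter fun i ↦ decide (x i = 1)).map fun i ↦ normTwoReflectionEquiv hB (r i) ε (hr i) hε),
            hPw x⟩ =
        Quot.mk _ ⟨wordProd (((List.finRange N).filter fun i ↦ decide (y i = 1)).map
            fun i ↦ normTwoReflectionEquiv hB (r i) ε (hr i) hε), hPw y⟩ ↔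
      IsWordIn {ψ : B.IsometryEquiv B | ∃ α β : B.IsometryEquiv B, P α ∧ P β ∧ ψ = ((β.symm.trans α.symm).trans β).trans α}
        (wordProd (((List.finRange N).filter fun i ↦ decide ((x + y) i = 1)).map
          fun i ↦ normTwoReflectionEquiv hB (r i) ε (hr i) hε)) := fun x y ↦ by
    rw [Quot.eq, hequiv.eqvGen_iff]
    change IsWordIn _ ((wordProd (((List.finRange N).filter fun i ↦ decide (x i = 1)).map
        fun i ↦ normTwoReflectionEquiv hB (r i) ε (hr i) hε)).trans
      (wordProd (((List.finRange N).filter fun i ↦ decide (y i = 1)).map fun i ↦ normTwoReflectionEquiv hB (r i) ε (hr i) hε)).symm) ↔ _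
    have hpar : ∀ i, Even ((((List.finRange N).filter fun i ↦ decide (x i = 1)) ++
        ((List.finRange N).filter fun i ↦ decide (y i = 1)).reverse).count i +
        ((List.finRange N).filter fun i ↦ decide ((x + y) i = 1)).count i) := fun i ↦ by
      rw [List.count_append, List.count_reverse, hcount, hcount, hcount, Pi.add_apply]
      exact key (x i) (y i)
    rw [← isWordIn_commutators_wordProd_iff_of_forall_even htrans hsymm hσP hσσ _ _ hpar]
    exact ⟨fun h ↦ h.congr fun w ↦ wordProd_trans_wordProd_symm_apply_of_involutive hσσ _ _ w,
      fun h ↦ h.congr fun w ↦ (wordProd_trans_wordProd_symm_apply_of_involutive hσσ _ _ w).symm⟩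
  -- every class is the class of a sublist-product (Theorem 1.3 (A) + the generation hypothesis)
  have hsurj : ∀ q : Quot fun φ ρ : {φ : B.IsometryEquiv B // P φ} ↦
      IsWordIn {ψ : B.IsometryEquiv B | ∃ α β : B.IsometryEquiv B, P α ∧ P β ∧ ψ = ((β.symm.trans α.symm).trans β).trans α}
        (φ.1.trans ρ.1.symm),
      ∃ x : Fin N → ZMod 2, Quot.mk _ ⟨wordProd (((List.finRange N).filter fun i ↦ decide (x i = 1)).map
        fun i ↦ normTwoReflectionEquiv hB (r i) ε (hr i) hε), hPw x⟩ = q := by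
    refine Quot.ind fun φ ↦ ?_
    obtain ⟨l, hl, hrel⟩ := exists_sublist_finRange_isWordIn_commutators_reflectionWord hB hε htrans hsymm hP r hr horbit
      (hgen φ.1 φ.2)
    have hnd : l.Nodup := hl.nodup (List.nodup_finRange N)
    refine ⟨fun i ↦ if i ∈ l then 1 else 0, Quot.sound ?_⟩
    change IsWordIn _ ((wordProd (((List.finRange N).filter fun i ↦ decide ((if i ∈ l then (1 : ZMod 2) else 0) = 1)).map
      fun i ↦ normTwoReflectionEquiv hB (r i) ε (hr i) hε)).trans φ.1.symm)
    refine IsWordIn.commutators_rel_trans ?_ hrel.commutators_rel_symm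
    refine isWordIn_commutators_wordProd_trans_wordProd_symm_of_forall_even htrans hsymm hσP hσσ _ l fun i ↦ ?_
    rw [hcount]
    by_cases hi : i ∈ l
    · rw [if_pos hi, if_pos rfl, List.count_eq_one_of_mem hnd hi]
      exact even_two
    · rw [if_neg hi, if_neg zero_ne_one, List.count_eq_zero.2 hi]
      exact ⟨0, rfl⟩
  -- the vectors giving the trivial class form a subgroup `K` of `(ℤ/2ℤ)^N`
  let K : AddSubgroup (Fin N → ZMod 2) :=
    { carrier := {x | Quot.mk (fun φ ρ : {φ : B.IsometryEquiv B // P φ} ↦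
          IsWordIn {ψ : B.IsometryEquiv B | ∃ α β : B.IsometryEquiv B, P α ∧ P β ∧ ψ = ((β.symm.trans α.symm).trans β).trans α}
            (φ.1.trans ρ.1.symm))
          ⟨wordProd (((List.finRange N).filter fun i ↦ decide (x i = 1)).map fun i ↦ normTwoReflectionEquiv hB (r i) ε (hr i) hε),
            hPw x⟩ =
        Quot.mk _ ⟨wordProd (((List.finRange N).filter fun i ↦ decide ((0 : Fin N → ZMod 2) i = 1)).map
            fun i ↦ normTwoReflectionEquiv hB (r i) ε (hr i) hε), hPw 0⟩}
      zero_mem' := rfl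
      add_mem' := fun {x y} hx hy ↦ by
        have hx' := (hkey x 0).1 hx
        have hy' := (hkey y 0).1 hy
        rw [add_zero] at hx' hy'
        refine (hkey (x + y) 0).2 ?_
        rw [add_zero]
        exact ((hkey x y).1 (hx.trans hy.symm))
      neg_mem' := fun {x} hx ↦ by
        have hneg : -x = x := funext fun i ↦ ZMod.neg_eq_self_mod_two (x i)
        rw [hneg]
        exact hx }
  have hKiff : ∀ x y : Fin N → ZMod 2,
      Quot.mk (fun φ ρ : {φ : B.IsometryEquiv B // P φ} ↦
          IsWordIn {ψ : B.IsometryEquiv B | ∃ α β : B.IsometryEquiv B, P α ∧ P β ∧ ψ = ((β.symm.trans α.symm).trans β).trans α}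
            (φ.1.trans ρ.1.symm))
          ⟨wordProd (((List.finRange N).filter fun i ↦ decide (x i = 1)).map fun i ↦ normTwoReflectionEquiv hB (r i) ε (hr i) hε),
            hPw x⟩ =
        Quot.mk _ ⟨wordProd (((List.finRange N).filter fun i ↦ decide (y i = 1)).map
            fun i ↦ normTwoReflectionEquiv hB (r i) ε (hr i) hε), hPw y⟩ ↔ -x + y ∈ K := fun x y ↦ by
    have hneg : -x = x := funext fun i ↦ ZMod.neg_eq_self_mod_two (x i)
    rw [hneg, hkey]
    change _ ↔ Quot.mk _ _ = Quot.mk _ _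
    rw [hkey, add_zero]
  -- the induced map `(ℤ/2ℤ)^N / K → P^{ab}` is a bijection
  let g : (Fin N → ZMod 2) ⧸ K → Quot fun φ ρ : {φ : B.IsometryEquiv B // P φ} ↦
      IsWordIn {ψ : B.IsometryEquiv B | ∃ α β : B.IsometryEquiv B, P α ∧ P β ∧ ψ = ((β.symm.trans α.symm).trans β).trans α}
        (φ.1.trans ρ.1.symm) := fun q ↦
    Quotient.liftOn' q (fun x ↦ Quot.mk _ ⟨wordProd (((List.finRange N).filter fun i ↦ decide (x i = 1)).map
      fun i ↦ normTwoReflectionEquiv hB (r i) ε (hr i) hε), hPw x⟩) fun x y h ↦ (hKiff x y).2 (QuotientAddGroup.leftRel_apply.1 h)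
  have hg : Function.Bijective g := by
    refine ⟨fun a b hab ↦ ?_, fun q ↦ ?_⟩
    · obtain ⟨x, rfl⟩ := QuotientAddGroup.mk_surjective a
      obtain ⟨y, rfl⟩ := QuotientAddGroup.mk_surjective b
      exact QuotientAddGroup.eq.2 ((hKiff x y).1 hab)
    · obtain ⟨x, hx⟩ := hsurj q
      exact ⟨QuotientAddGroup.mk x, hx⟩
  calc Nat.card (Quot fun φ ρ : {φ : B.IsometryEquiv B // P φ} ↦
        IsWordIn {ψ : B.IsometryEquiv B | ∃ α β : B.IsometryEquiv B, P α ∧ P β ∧ ψ = ((β.symm.trans α.symm).trans β).trans α}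
          (φ.1.trans ρ.1.symm))
      = Nat.card ((Fin N → ZMod 2) ⧸ K) := (Nat.card_eq_of_bijective g hg).symm
    _ ∣ Nat.card (Fin N → ZMod 2) := AddSubgroup.card_quotient_dvd_card K
    _ = 2 ^ N := by simp

/-- **Theorem 1.3 (B), inequality form**: under the same hypotheses the number of classes of `P` modulo `[P, P]`-words is at
most `2^N`. [cite: GritsenkoHulekSankaran2009, Thm. 1.3] -/
theorem natCard_quot_commutators_le_two_pow (hB : B.IsSymm) {ε : ℤ} (hε : ε * ε = 1)
    (h1 : P (LinearMap.BilinForm.IsometryEquiv.refl B)) (htrans : ∀ α β : B.IsometryEquiv B, P α → P β → P (α.trans β))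
    (hsymm : ∀ α : B.IsometryEquiv B, P α → P α.symm) (hP : ∀ (a : W) (ha : B a a = ε + ε), P (normTwoReflectionEquiv hB a ε ha hε))
    (hgen : ∀ φ : B.IsometryEquiv B, P φ →
      IsWordIn {ψ : B.IsometryEquiv B | ∃ (a : W) (ha : B a a = ε + ε), ψ = normTwoReflectionEquiv hB a ε ha hε} φ)
    {N : ℕ} (r : Fin N → W) (hr : ∀ i, B (r i) (r i) = ε + ε)
    (horbit : ∀ a : W, B a a = ε + ε → ∃ (i : Fin N) (g : B.IsometryEquiv B), P g ∧ g (r i) = a) :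
    Nat.card (Quot fun φ ρ : {φ : B.IsometryEquiv B // P φ} ↦
      IsWordIn {ψ : B.IsometryEquiv B | ∃ α β : B.IsometryEquiv B, P α ∧ P β ∧ ψ = ((β.symm.trans α.symm).trans β).trans α}
        (φ.1.trans ρ.1.symm)) ≤ 2 ^ N :=
  Nat.le_of_dvd (by positivity) (natCard_quot_commutators_dvd_two_pow hB hε h1 htrans hsymm hP hgen r hr horbit)

/-- **Theorem 1.3 (B) with ONE orbit (`N = 1`): the order of `P^{ab}` divides `2`** when any two `(2ε)`-roots are
`P`-equivalent and `L` has a `(2ε)`-root. [cite: GritsenkoHulekSankaran2009, Thm. 1.3 and Prop. 1.6 ("Õ⁺(L)^{ab} ≅ ℤ/2ℤ")] -/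
theorem natCard_quot_commutators_dvd_two_of_forall_exists (hB : B.IsSymm) {ε : ℤ} (hε : ε * ε = 1)
    (h1 : P (LinearMap.BilinForm.IsometryEquiv.refl B)) (htrans : ∀ α β : B.IsometryEquiv B, P α → P β → P (α.trans β))
    (hsymm : ∀ α : B.IsometryEquiv B, P α → P α.symm) (hP : ∀ (a : W) (ha : B a a = ε + ε), P (normTwoReflectionEquiv hB a ε ha hε))
    (hgen : ∀ φ : B.IsometryEquiv B, P φ →
      IsWordIn {ψ : B.IsometryEquiv B | ∃ (a : W) (ha : B a a = ε + ε), ψ = normTwoReflectionEquiv hB a ε ha hε} φ)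
    {r₀ : W} (hr₀ : B r₀ r₀ = ε + ε)
    (horbit : ∀ a b : W, B a a = ε + ε → B b b = ε + ε → ∃ g : B.IsometryEquiv B, P g ∧ g a = b) :
    Nat.card (Quot fun φ ρ : {φ : B.IsometryEquiv B // P φ} ↦
      IsWordIn {ψ : B.IsometryEquiv B | ∃ α β : B.IsometryEquiv B, P α ∧ P β ∧ ψ = ((β.symm.trans α.symm).trans β).trans α}
        (φ.1.trans ρ.1.symm)) ∣ 2 := by
  have h := natCard_quot_commutators_dvd_two_pow hB hε h1 htrans hsymm hP hgen (N := 1) (fun _ ↦ r₀) (fun _ ↦ hr₀)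
    fun a ha ↦ by
      obtain ⟨g, hg, hga⟩ := horbit r₀ a hr₀ ha
      exact ⟨0, g, hg, hga⟩
  rwa [pow_one] at h

end Reflections

/-! ### §4 Instances: `P = O⁺(L)`, one orbit of `(−2)`-vectors -/

section OrientationPreserving

variable {V : Type u} [AddCommGroup V] [Module.Finite ℤ V] [Module.Free ℤ V] (Q : BilinForm ℤ V)

/-- **Thm. 1.3 for `Õ⁺(L) = O⁺(L)`, `L` even unimodular with `n± ≥ 2`, under the Kneser hypothesis `O⁺(L) = ⟨σ_a : a² = −2⟩`**:
the `(−2)`-vectors form ONE `O⁺(L)`-orbit (GHS 2008 Prop. 2.4 (i)) and `L ⊇ U ⊕ U` has a `(−2)`-vector, so the order of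
`O⁺(L)^{ab}` (the number of classes of `O⁺(L)` modulo words in commutators of `O⁺(L)`) divides `2`.
[cite: GritsenkoHulekSankaran2009, Thm. 1.3 and Prop. 1.6] [cite: GritsenkoHulekSankaran2008Proportionality, Prop. 2.4 (i)] -/
theorem natCard_quot_isOrientationPreserving_commutators_dvd_two_of_isUnimodular (hs : Q.IsSymm) (hu : Q.IsUnimodular)
    (he : Q.IsEven) (h2 : 2 ≤ sigPos Q.toQuadraticMap) (h2' : 2 ≤ sigNeg Q.toQuadraticMap)
    (hK : ∀ φ : Q.IsometryEquiv Q, φ.IsOrientationPreserving →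
      IsWordIn {ψ : Q.IsometryEquiv Q | ∃ (a : V) (ha : Q a a = -1 + -1), ψ = normTwoReflectionEquiv hs a (-1) ha (by norm_num)} φ) :
    Nat.card (Quot fun φ ρ : {φ : Q.IsometryEquiv Q // φ.IsOrientationPreserving} ↦
      IsWordIn {ψ : Q.IsometryEquiv Q | ∃ α β : Q.IsometryEquiv Q, α.IsOrientationPreserving ∧ β.IsOrientationPreserving ∧
        ψ = ((β.symm.trans α.symm).trans β).trans α} (φ.1.trans ρ.1.symm)) ∣ 2 := by
  have hnd := hu.nondegenerate
  obtain ⟨x, y, x₁, y₁, hxy⟩ := exists_twoHyperbolicPairs_of_isEven_of_isUnimodular Q hs hu he h2 h2'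
  have hr₀ : Q (x - y) (x - y) = -1 + -1 := by
    simp only [map_sub, LinearMap.sub_apply, hxy.xx, hxy.yy, hxy.xy, hs.eq y x]
    norm_num
  refine natCard_quot_commutators_dvd_two_of_forall_exists (P := fun φ : Q.IsometryEquiv Q ↦ φ.IsOrientationPreserving) hs
    (ε := -1) (by norm_num) LinearMap.BilinForm.IsometryEquiv.IsOrientationPreserving.refl (fun α β hα hβ ↦
      (LinearMap.BilinForm.IsometryEquiv.isOrientationPreserving_trans_iff hs hnd α β).2 (iff_of_true hβ hα))
    (fun α hα ↦ (LinearMap.BilinForm.IsometryEquiv.isOrientationPreserving_symm_iff hs hnd α).2 hα)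
    (fun a ha ↦ (isOrientationPreserving_normTwoReflectionEquiv_iff _ hs hnd a (-1) ha _).2 rfl) hK hr₀ fun a b ha hb ↦
    exists_isometryEquiv_isOrientationPreserving_apply_eq_of_apply_self_eq_neg_two Q hs hu he h2 h2' (by rw [ha]; norm_num)
      (by rw [hb]; norm_num)

end OrientationPreserving

section HyperbolicSum

/-- **Thm. 1.3 for `O⁺(U^{⊕n})`, `n ≥ 3`, unconditionally**: `O⁺(U^{⊕n})` is generated by the `(−2)`-reflections (row g49-#15,
Kneser / GHS Thm. 1.1) and its `(−2)`-vectors form one orbit, so the order of `O⁺(U^{⊕n})^{ab}` divides `2` (row g50-#6: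
it equals `2`, Thm. 1.7 / Prop. 1.6 — the bound of Thm. 1.3 is attained). [cite: GritsenkoHulekSankaran2009, Thm. 1.3, Thm. 1.1 and Prop. 1.6] [cite: GritsenkoHulekSankaran2008Proportionality, Prop. 2.4 (i)] -/
theorem hyperbolicSum_natCard_quot_isOrientationPreserving_commutators_dvd_two {n : ℕ} (hn : 3 ≤ n) :
    Nat.card (Quot fun φ ρ : {φ : (hyperbolicSum n).IsometryEquiv (hyperbolicSum n) // φ.IsOrientationPreserving} ↦
      IsWordIn {ψ | ∃ α β : (hyperbolicSum n).IsometryEquiv (hyperbolicSum n), α.IsOrientationPreserving ∧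
        β.IsOrientationPreserving ∧ ψ = ((β.symm.trans α.symm).trans β).trans α} (φ.1.trans ρ.1.symm)) ∣ 2 := by
  obtain ⟨hp, hm⟩ := sigPos_sigNeg_hyperbolicSum n
  exact natCard_quot_isOrientationPreserving_commutators_dvd_two_of_isUnimodular _ (isSymm_hyperbolicSum n)
    (isUnimodular_hyperbolicSum n) (isEven_hyperbolicSum n) (by omega) (by omega)
    fun φ hφ ↦ (hyperbolicSum_isWordIn_negTwoReflections_iff hn φ).2 hφ

end HyperbolicSum

end Literature.Topology.FourManifolds

end
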